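import Summits.CriticalPhenomena.SAWScalingLimit.Theorems.SAWDevelopingMapNoFoldBoundInteriorPointwise
import Summits.CriticalPhenomena.SAWScalingLimit.Theorems.SAWDevelopingMapNoFoldBoundSealedPort
import Summits.CriticalPhenomena.SAWScalingLimit.Theorems.SAWDevelopingMapNoFoldBoundBoundaryLayer
import Summits.CriticalPhenomena.SAWScalingLimit.Theorems.SAWDevelopingMapNoFoldBoundWalledPorts
import Summits.CriticalPhenomena.SAWScalingLimit.Theorems.SAWDevelopingMapNoFoldBoundAlgebra
import Summits.CriticalPhenomena.SAWScalingLimit.Theorems.SAWDevelopingMapNoFoldBoundPortRenewal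
import Summits.CriticalPhenomena.SAWScalingLimit.Theorems.SAWDevelopingMapNoFoldBoundSlitSC
import Summits.CriticalPhenomena.SAWScalingLimit.Theorems.SAWDevelopingMapNoFoldBoundSourceLoopReduction

/-!
# `NoFoldBound`, line Ideator3Sketch — the collar reduction: (K) modulo (M) and `SourceLoopBound`

Crux `NoFoldBound` (K, stmt-CriticalPhenomena-8296), route `SAWDevelopingMap`, lead seat c3. The route's
deciding theorem `closes` consumes (K) next to the sibling crux `InteriorFlattening` (M,
stmt-CriticalPhenomena-8297), which flattens the Beltrami quotient of the observable at every `R`-deep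
vertex. This file records what (K) adds to (M): with `CollarCoherence R k` the slit-coherence inequality
(first-arrival form of the landed reduction, positive labelling) at the fed, unsealed interior vertices that
are NOT `R`-deep (some vertex within Euclidean distance `R` lies outside the domain),

* `collar_interior_of_hyps` — `SourceLoopBound` and collar coherence at radius `R` give the no-fold
  inequality with one `k < 1` at every interior vertex off the source mid-edge that is not `R`-deep
  (sealed stratum: `slitCoherence_sealed`; the rest: the hypothesis; glue: `interior_labellings_at`);
* `noFoldBound_of_sourceLoopBound_of_interiorFlattening_of_collar` —
  `SourceLoopBound → InteriorFlattening → (∀ R, ∃ k < 1, CollarCoherence R k) → NoFoldBound`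
  (boundary layer: `boundaryLayer_of_hyps`; `R₀`-deep vertices: (M) at `ε = 1/2`; collar: the above);
* `collarCoherence_of_noFoldBound` — conversely (K) gives collar coherence at every radius with its own
  `k` (`slitCoherence_of_noFoldBound`, hypotheses dropped);
* `noFoldBound_iff_of_interiorFlattening` — under (M):
  `NoFoldBound ↔ SourceLoopBound ∧ ∀ R, ∃ k < 1, CollarCoherence R k`.

So the two cruxes PARTITION the open content: (K) ∧ (M) ⟺ (M) ∧ SourceLoopBound ∧ (collar coherence at
every finite depth); the 8297 line's `bulkNoFold_iff_deepSlitCoherence` is the mirror statement for the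
deep stratum. For `R < √3` the collar hypothesis is vacuous; the first stratum (`√3 ≤ R < 2`, a neighbour of
`v` touches `Λᶜ`) is the depth-2 stratum with three rigid winding classes (`helper_depthTwoClasses`), where
a fold is equivalent to middle-port starvation of the first-arrival masses. Nothing unproved is asserted:
(K), (M), `SourceLoopBound` and collar coherence enter only as hypotheses. [folklore glue]
-/

noncomputable section

open scoped BigOperators
open Literature.Probability.LatticeModels Literature.Probability.RandomPlanarGeometry.SAW

namespace Summit.CriticalPhenomena.SAWScalingLimit.Theorems.SAWDevelopingMapNoFoldBound

/-- **The interior collar from `SourceLoopBound` and collar coherence (hypotheses form).** At every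
vertex off the source mid-edge, all neighbours inside, NOT `R`-deep, every labelling, the no-fold
inequality holds with one `k < 1`: the sealed-port stratum is `slitCoherence_sealed hSLB`, its complement
is the collar-coherence hypothesis at radius `R`, and `interior_labellings_at` (port renewal + slit
simple connectivity, landed) turns coherence at the vertex into the six labelled inequalities there. -/
theorem collar_interior_of_hyps
    (hSLB : Summit.CriticalPhenomena.SAWScalingLimit.Theses.SAWDevelopingMap.SourceLoopBound) {R : ℝ}
    (hCol : ∃ k : ℝ, k < 1 ∧ ∀ (Λ : Finset HexVertex), hexDomainSimplyConnected Λ →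
      ∀ a ∈ hexDomainBoundary Λ, ∀ v ∈ Λ, v ∉ a → (∀ u : HexVertex, hexGraph.Adj v u → u ∈ Λ) →
      (∀ w : HexVertex, hexGraph.Adj v w → ∃ y : HexVertex, hexGraph.Adj w y ∧ y ≠ v ∧ y ∈ Λ) →
      (∃ w : HexVertex, dist (hexCenter w) (hexCenter v) ≤ R ∧ w ∉ Λ) →
      ∀ w₀ w₁ w₂ : HexVertex, hexGraph.Adj v w₀ → hexGraph.Adj v w₁ → hexGraph.Adj v w₂ →
      w₀ ≠ w₁ → w₁ ≠ w₂ → w₀ ≠ w₂ →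
      winding [hexMidpoint s(w₀, v), hexCenter v, hexMidpoint s(v, w₁)] = Real.pi / 3 →
      let x : ℝ := hexCriticalFugacity
      let α : ℝ := 1 + 2 * hexCriticalFugacity * Real.cos (5 * Real.pi / 24)
      let β : ℝ := 1 + 2 * hexCriticalFugacity * Real.cos (11 * Real.pi / 24)
      let ω : ℂ := Complex.exp (2 * Real.pi * Complex.I / 3)
      let Z : (w p q : HexVertex) → HexMidEdgeSAW Λ a s(v, w) → ℝ :=
        fun w p q (γ : HexMidEdgeSAW Λ a s(v, w)) =>
        ∑ δ : HexMidEdgeSAW ((Λ \ γ.verts.toFinset).erase v) s(v, p) s(v, q), x ^ δ.length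
      let B : (w p q : HexVertex) → ℂ := fun w p q =>
        ∑ γ : HexMidEdgeSAW Λ a s(v, w), if v ∉ γ.verts then
          γ.weight x (5 / 8) * ((β + Real.sqrt 3 * x * Z w p q γ : ℝ) : ℂ) else 0
      let S : (w p q : HexVertex) → ℂ := fun w p q =>
        ∑ γ : HexMidEdgeSAW Λ a s(v, w), if v ∉ γ.verts then
          γ.weight x (5 / 8) * ((α - Real.sqrt 3 * x * Z w p q γ : ℝ) : ℂ) else 0
      ‖B w₀ w₁ w₂ + ω * B w₁ w₂ w₀ + ω ^ 2 * B w₂ w₀ w₁‖ ≤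
        k * ‖S w₀ w₁ w₂ + S w₁ w₂ w₀ + S w₂ w₀ w₁‖) :
    ∃ k : ℝ, k < 1 ∧ ∀ (Λ : Finset HexVertex), hexDomainSimplyConnected Λ →
      ∀ a ∈ hexDomainBoundary Λ, ∀ v ∈ Λ, v ∉ a → (∀ u : HexVertex, hexGraph.Adj v u → u ∈ Λ) →
      (∃ w : HexVertex, dist (hexCenter w) (hexCenter v) ≤ R ∧ w ∉ Λ) →
      ∀ w₀ w₁ w₂ : HexVertex, hexGraph.Adj v w₀ → hexGraph.Adj v w₁ → hexGraph.Adj v w₂ →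
      w₀ ≠ w₁ → w₁ ≠ w₂ → w₀ ≠ w₂ →
      let F : Sym2 HexVertex → ℂ := hexParafermionicObservable Λ a hexCriticalFugacity (5 / 8)
      let ω : ℂ := Complex.exp (2 * Real.pi * Complex.I / 3)
      ‖F s(v, w₀) + ω * F s(v, w₁) + ω ^ 2 * F s(v, w₂)‖ ≤
        k * ‖F s(v, w₀) + F s(v, w₁) + F s(v, w₂)‖ := by
  obtain ⟨k₁, hk₁, H₁⟩ := slitCoherence_sealed hSLB
  obtain ⟨k₂, hk₂, H₂⟩ := hCol
  refine ⟨max (max k₁ k₂) 0, max_lt (max_lt hk₁ hk₂) one_pos, ?_⟩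
  intro Λ hΛ a ha v hv hva hint hnd w₀ w₁ w₂ h₀ h₁ h₂ h₀₁ h₁₂ h₀₂
  refine interior_labellings_at stub_portRenewal stub_slitSC hΛ ha hv hva ?_ h₀ h₁ h₂ h₀₁ h₁₂ h₀₂
  intro p q r hp hq hr hpq hqr hpr hchir
  by_cases hs : ∃ w : HexVertex, hexGraph.Adj v w ∧ ∀ y : HexVertex, hexGraph.Adj w y → y ≠ v → y ∉ Λ
  · have h := H₁ Λ hΛ a ha v hv hva hint hs p q r hp hq hr hpq hqr hpr hchir
    dsimp only at h ⊢
    exact h.trans (mul_le_mul_of_nonneg_right (le_max_left _ _) (norm_nonneg _))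
  · push Not at hs
    have h := H₂ Λ hΛ a ha v hv hva hint (fun w hw => hs w hw) hnd p q r hp hq hr hpq hqr hpr hchir
    dsimp only at h ⊢
    exact h.trans (mul_le_mul_of_nonneg_right (le_max_right _ _) (norm_nonneg _))

/-- **(K) from `SourceLoopBound`, (M) and collar coherence at every radius.** Case split on the
position of the vertex: boundary layer (source mid-edge or a neighbour outside: `boundaryLayer_of_hyps`
with the landed leaves), `R₀`-deep (flattened by `InteriorFlattening` at `ε = 1/2`), collar
(`collar_interior_of_hyps` at `R₀`); `k = max (max k₁ k₂) (1/2)`. -/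
theorem noFoldBound_of_sourceLoopBound_of_interiorFlattening_of_collar
    (hSLB : Summit.CriticalPhenomena.SAWScalingLimit.Theses.SAWDevelopingMap.SourceLoopBound)
    (hM : Summit.CriticalPhenomena.SAWScalingLimit.Theses.SAWDevelopingMap.InteriorFlattening)
    (hCol : ∀ R : ℝ, ∃ k : ℝ, k < 1 ∧ ∀ (Λ : Finset HexVertex), hexDomainSimplyConnected Λ →
      ∀ a ∈ hexDomainBoundary Λ, ∀ v ∈ Λ, v ∉ a → (∀ u : HexVertex, hexGraph.Adj v u → u ∈ Λ) →
      (∀ w : HexVertex, hexGraph.Adj v w → ∃ y : HexVertex, hexGraph.Adj w y ∧ y ≠ v ∧ y ∈ Λ) →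
      (∃ w : HexVertex, dist (hexCenter w) (hexCenter v) ≤ R ∧ w ∉ Λ) →
      ∀ w₀ w₁ w₂ : HexVertex, hexGraph.Adj v w₀ → hexGraph.Adj v w₁ → hexGraph.Adj v w₂ →
      w₀ ≠ w₁ → w₁ ≠ w₂ → w₀ ≠ w₂ →
      winding [hexMidpoint s(w₀, v), hexCenter v, hexMidpoint s(v, w₁)] = Real.pi / 3 →
      let x : ℝ := hexCriticalFugacity
      let α : ℝ := 1 + 2 * hexCriticalFugacity * Real.cos (5 * Real.pi / 24)
      let β : ℝ := 1 + 2 * hexCriticalFugacity * Real.cos (11 * Real.pi / 24)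
      let ω : ℂ := Complex.exp (2 * Real.pi * Complex.I / 3)
      let Z : (w p q : HexVertex) → HexMidEdgeSAW Λ a s(v, w) → ℝ :=
        fun w p q (γ : HexMidEdgeSAW Λ a s(v, w)) =>
        ∑ δ : HexMidEdgeSAW ((Λ \ γ.verts.toFinset).erase v) s(v, p) s(v, q), x ^ δ.length
      let B : (w p q : HexVertex) → ℂ := fun w p q =>
        ∑ γ : HexMidEdgeSAW Λ a s(v, w), if v ∉ γ.verts then
          γ.weight x (5 / 8) * ((β + Real.sqrt 3 * x * Z w p q γ : ℝ) : ℂ) else 0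
      let S : (w p q : HexVertex) → ℂ := fun w p q =>
        ∑ γ : HexMidEdgeSAW Λ a s(v, w), if v ∉ γ.verts then
          γ.weight x (5 / 8) * ((α - Real.sqrt 3 * x * Z w p q γ : ℝ) : ℂ) else 0
      ‖B w₀ w₁ w₂ + ω * B w₁ w₂ w₀ + ω ^ 2 * B w₂ w₀ w₁‖ ≤
        k * ‖S w₀ w₁ w₂ + S w₁ w₂ w₀ + S w₂ w₀ w₁‖) :
    Summit.CriticalPhenomena.SAWScalingLimit.Theses.SAWDevelopingMap.NoFoldBound := by
  obtain ⟨k₁, hk₁, H₁⟩ := boundaryLayer_of_hyps stub_walledPorts stub_algebra.1 stub_algebra.2 hSLB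
  obtain ⟨R₀, HM⟩ := hM (1 / 2) one_half_pos
  obtain ⟨k₂, hk₂, H₂⟩ := collar_interior_of_hyps hSLB (hCol R₀)
  refine ⟨max (max k₁ k₂) (1 / 2), max_lt (max_lt hk₁ hk₂) one_half_lt_one, ?_⟩
  intro Λ hΛ a ha v hv w₀ w₁ w₂ h₀ h₁ h₂ h₀₁ h₁₂ h₀₂
  by_cases hb : v ∈ a ∨ ∃ u : HexVertex, hexGraph.Adj v u ∧ u ∉ Λ
  · have h := H₁ Λ hΛ a ha v hv hb w₀ w₁ w₂ h₀ h₁ h₂ h₀₁ h₁₂ h₀₂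
    dsimp only at h ⊢
    exact h.trans (mul_le_mul_of_nonneg_right ((le_max_left _ _).trans (le_max_left _ _))
      (norm_nonneg _))
  · push Not at hb
    by_cases hd : ∀ w : HexVertex, dist (hexCenter w) (hexCenter v) ≤ R₀ → w ∈ Λ
    · have h := HM Λ hΛ a ha v hv hd w₀ w₁ w₂ h₀ h₁ h₂ h₀₁ h₁₂ h₀₂
      dsimp only at h ⊢
      exact h.trans (mul_le_mul_of_nonneg_right (le_max_right _ _) (norm_nonneg _))
    · push Not at hd
      have h := H₂ Λ hΛ a ha v hv hb.1 (fun u hu => hb.2 u hu) hd w₀ w₁ w₂ h₀ h₁ h₂ h₀₁ h₁₂ h₀₂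
      dsimp only at h ⊢
      exact h.trans (mul_le_mul_of_nonneg_right ((le_max_right _ _).trans (le_max_left _ _))
        (norm_nonneg _))

/-- **Conversely, (K) gives collar coherence at every radius** (with the `k` of (K)): slit coherence
at ALL interior vertices follows from `NoFoldBound` (`slitCoherence_of_noFoldBound` with the landed port
renewal and slit simple connectivity), and the collar statement only adds hypotheses. -/
theorem collarCoherence_of_noFoldBound
    (h : Summit.CriticalPhenomena.SAWScalingLimit.Theses.SAWDevelopingMap.NoFoldBound) :
    ∀ R : ℝ, ∃ k : ℝ, k < 1 ∧ ∀ (Λ : Finset HexVertex), hexDomainSimplyConnected Λ →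
      ∀ a ∈ hexDomainBoundary Λ, ∀ v ∈ Λ, v ∉ a → (∀ u : HexVertex, hexGraph.Adj v u → u ∈ Λ) →
      (∀ w : HexVertex, hexGraph.Adj v w → ∃ y : HexVertex, hexGraph.Adj w y ∧ y ≠ v ∧ y ∈ Λ) →
      (∃ w : HexVertex, dist (hexCenter w) (hexCenter v) ≤ R ∧ w ∉ Λ) →
      ∀ w₀ w₁ w₂ : HexVertex, hexGraph.Adj v w₀ → hexGraph.Adj v w₁ → hexGraph.Adj v w₂ →
      w₀ ≠ w₁ → w₁ ≠ w₂ → w₀ ≠ w₂ →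
      winding [hexMidpoint s(w₀, v), hexCenter v, hexMidpoint s(v, w₁)] = Real.pi / 3 →
      let x : ℝ := hexCriticalFugacity
      let α : ℝ := 1 + 2 * hexCriticalFugacity * Real.cos (5 * Real.pi / 24)
      let β : ℝ := 1 + 2 * hexCriticalFugacity * Real.cos (11 * Real.pi / 24)
      let ω : ℂ := Complex.exp (2 * Real.pi * Complex.I / 3)
      let Z : (w p q : HexVertex) → HexMidEdgeSAW Λ a s(v, w) → ℝ :=
        fun w p q (γ : HexMidEdgeSAW Λ a s(v, w)) =>
        ∑ δ : HexMidEdgeSAW ((Λ \ γ.verts.toFinset).erase v) s(v, p) s(v, q), x ^ δ.length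
      let B : (w p q : HexVertex) → ℂ := fun w p q =>
        ∑ γ : HexMidEdgeSAW Λ a s(v, w), if v ∉ γ.verts then
          γ.weight x (5 / 8) * ((β + Real.sqrt 3 * x * Z w p q γ : ℝ) : ℂ) else 0
      let S : (w p q : HexVertex) → ℂ := fun w p q =>
        ∑ γ : HexMidEdgeSAW Λ a s(v, w), if v ∉ γ.verts then
          γ.weight x (5 / 8) * ((α - Real.sqrt 3 * x * Z w p q γ : ℝ) : ℂ) else 0
      ‖B w₀ w₁ w₂ + ω * B w₁ w₂ w₀ + ω ^ 2 * B w₂ w₀ w₁‖ ≤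
        k * ‖S w₀ w₁ w₂ + S w₁ w₂ w₀ + S w₂ w₀ w₁‖ := by
  intro R
  obtain ⟨k, hk, H⟩ := slitCoherence_of_noFoldBound stub_portRenewal stub_slitSC h
  refine ⟨k, hk, ?_⟩
  intro Λ hΛ a ha v hv hva hint _ _ w₀ w₁ w₂ h₀ h₁ h₂ h₀₁ h₁₂ h₀₂ hchir
  exact H Λ hΛ a ha v hv hva hint w₀ w₁ w₂ h₀ h₁ h₂ h₀₁ h₁₂ h₀₂ hchir

/-- **The collar reduction: under (M), (K) is exactly `SourceLoopBound` plus collar coherence at every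
radius.** Forward: `sourceLoopBound_of_noFoldBound` (landed converse at the source vertex) and
`collarCoherence_of_noFoldBound`; backward: `noFoldBound_of_sourceLoopBound_of_interiorFlattening_of_collar`. -/
theorem noFoldBound_iff_of_interiorFlattening
    (hM : Summit.CriticalPhenomena.SAWScalingLimit.Theses.SAWDevelopingMap.InteriorFlattening) :
    Summit.CriticalPhenomena.SAWScalingLimit.Theses.SAWDevelopingMap.NoFoldBound ↔
      (Summit.CriticalPhenomena.SAWScalingLimit.Theses.SAWDevelopingMap.SourceLoopBound ∧
        ∀ R : ℝ, ∃ k : ℝ, k < 1 ∧ ∀ (Λ : Finset HexVertex), hexDomainSimplyConnected Λ →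
      ∀ a ∈ hexDomainBoundary Λ, ∀ v ∈ Λ, v ∉ a → (∀ u : HexVertex, hexGraph.Adj v u → u ∈ Λ) →
      (∀ w : HexVertex, hexGraph.Adj v w → ∃ y : HexVertex, hexGraph.Adj w y ∧ y ≠ v ∧ y ∈ Λ) →
      (∃ w : HexVertex, dist (hexCenter w) (hexCenter v) ≤ R ∧ w ∉ Λ) →
      ∀ w₀ w₁ w₂ : HexVertex, hexGraph.Adj v w₀ → hexGraph.Adj v w₁ → hexGraph.Adj v w₂ →
      w₀ ≠ w₁ → w₁ ≠ w₂ → w₀ ≠ w₂ →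
      winding [hexMidpoint s(w₀, v), hexCenter v, hexMidpoint s(v, w₁)] = Real.pi / 3 →
      let x : ℝ := hexCriticalFugacity
      let α : ℝ := 1 + 2 * hexCriticalFugacity * Real.cos (5 * Real.pi / 24)
      let β : ℝ := 1 + 2 * hexCriticalFugacity * Real.cos (11 * Real.pi / 24)
      let ω : ℂ := Complex.exp (2 * Real.pi * Complex.I / 3)
      let Z : (w p q : HexVertex) → HexMidEdgeSAW Λ a s(v, w) → ℝ :=
        fun w p q (γ : HexMidEdgeSAW Λ a s(v, w)) =>
        ∑ δ : HexMidEdgeSAW ((Λ \ γ.verts.toFinset).erase v) s(v, p) s(v, q), x ^ δ.length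
      let B : (w p q : HexVertex) → ℂ := fun w p q =>
        ∑ γ : HexMidEdgeSAW Λ a s(v, w), if v ∉ γ.verts then
          γ.weight x (5 / 8) * ((β + Real.sqrt 3 * x * Z w p q γ : ℝ) : ℂ) else 0
      let S : (w p q : HexVertex) → ℂ := fun w p q =>
        ∑ γ : HexMidEdgeSAW Λ a s(v, w), if v ∉ γ.verts then
          γ.weight x (5 / 8) * ((α - Real.sqrt 3 * x * Z w p q γ : ℝ) : ℂ) else 0
      ‖B w₀ w₁ w₂ + ω * B w₁ w₂ w₀ + ω ^ 2 * B w₂ w₀ w₁‖ ≤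
        k * ‖S w₀ w₁ w₂ + S w₁ w₂ w₀ + S w₂ w₀ w₁‖) :=
  ⟨fun h => ⟨sourceLoopBound_of_noFoldBound h, collarCoherence_of_noFoldBound h⟩,
    fun h => noFoldBound_of_sourceLoopBound_of_interiorFlattening_of_collar h.1 hM h.2⟩

end Summit.CriticalPhenomena.SAWScalingLimit.Theorems.SAWDevelopingMapNoFoldBound
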